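import Summits.AtomisticToContinuum.Crystallization.Theorems.ChartedZeroExcessLayeredLatticeLiouvilleZZZYRCXRC
import Summits.AtomisticToContinuum.Crystallization.Theorems.ChartedZeroExcessLayeredLatticeLiouvilleZZZYRCXRI
import Summits.AtomisticToContinuum.Crystallization.Theorems.ChartedZeroExcessLayeredLatticeLiouvilleZZZYRCZU

/-!
# ChartedZeroExcessLayeredLatticeLiouville · ZZZYRCXRB — THE θ⁰ OUT-OF-WINDOW KERNEL: THE DECODE BRIDGE TO LENS-2's LETTER SEQUENCES (§10)
(decomp-a2c hand-1 g55; target stmt-AtomisticToContinuum-26636 JS-D near reader, line (D) 5c θ_out; critic r1873 (B) «decode/assembly INTO lens-2's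
`KernelSlabSoundOut` … (key = `pieceKeyF`/`keyAtF`)»)

The out kernel of record runs with `wlo = 600`, `whi = 600 + 2H₀`, `amX = 600 + H₀` (shifted layer `am` ↔ window coordinate `am − 600`), so
that the tree's `decodeChord H₀` decodes its chords.  §10 bridges its letter ASSIGNMENTS `ρ : ℕ → ℕ` to lens-2's letter SEQUENCES
`ℓ : ℤ → ℤ` (RCZO `IsLetterSeq`, RCZU `AgreesOnWindow`): `rhoOf ℓ am := (ℓ (am − 600)).toNat`, ★ `admO_rhoOf` (a letter sequence agreeing
with the window word is an ADMISSIBLE assignment for the kernel), ★ `n9F_liftN_rho` / `d18F_liftN_rho` / `n9F_decodeChord_fst_rho`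
(lens-2's `n9F ℓ`, `d18F ℓ` of lifted pieces ARE the kernel's `n9Z`/`d18Z` of `vecL (rhoOf ℓ)`), the window-currency key code `codeKO` with
★ `keyOf_eq_codeKO` (`keyOf pr = codeKO (pieceKeyF (liftN pr))`, no truncation), and the coefficient majorants in letter-sequence currency
`coefR_real_le` / ★ `coefR0F_le_rho`.  Imports RCXRC + RCXRI + RCZU; 0 sorry.  All `[folklore]`.
-/

namespace Summit.AtomisticToContinuum.Crystallization.Theorems.ChartedZeroExcessLayeredLatticeLiouville.ThetaKernel

/-! ## §10 letter sequences ↔ letter assignments -/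

/-- the kernel's letter assignment of a letter sequence: shifted layer `am` carries the letter of window coordinate `am − 600`. -/
def rhoOf (ℓ : ℤ → ℤ) (am : ℕ) : ℕ := (ℓ ((am : ℤ) - 600)).toNat

/-- the assignment's letter, cast back, is the sequence's letter. [folklore] -/
theorem rhoOf_cast {ℓ : ℤ → ℤ} (hℓ : IsLetterSeq ℓ) (am : ℕ) : ((rhoOf ℓ am : ℕ) : ℤ) = ℓ ((am : ℤ) - 600) :=
  Int.toNat_of_nonneg (hℓ _).1

/-- the assignment's letters are `≤ 2`. [folklore] -/
theorem rhoOf_le_two {ℓ : ℤ → ℤ} (hℓ : IsLetterSeq ℓ) (am : ℕ) : rhoOf ℓ am ≤ 2 := by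
  have h := rhoOf_cast hℓ am
  have h2 := (hℓ ((am : ℤ) - 600)).2
  omega

/-- ★ a letter sequence agreeing with the window word `wordZ win` (`|win| = 2H₀ + 1`) on the window is an ADMISSIBLE assignment for the out
kernel run with `wlo = 600`, `whi = 600 + 2H₀`. [folklore] -/
theorem admO_rhoOf {ℓ : ℤ → ℤ} (hℓ : IsLetterSeq ℓ) {H₀ : ℕ} {win : List ℕ} (hwl : win.length = 2 * H₀ + 1)
    (hag : AgreesOnWindow H₀ (wordZ win) ℓ) : AdmO win 600 (600 + 2 * H₀) (rhoOf ℓ) := by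
  refine ⟨fun am ham => ?_, rhoOf_le_two hℓ⟩
  unfold inWin at ham
  rw [Bool.and_eq_true, Nat.ble_eq, Nat.ble_eq] at ham
  have h := rhoOf_cast hℓ am
  have hj : ℓ ((am : ℤ) - 600) = regW (wordZ win) ((am : ℤ) - 600) := hag _ (by omega) (by omega)
  rw [hj, regW_eq_getD (by omega) (by rw [length_wordZ]; omega)] at h
  have ht : (((am : ℤ) - 600).toNat) = am - 600 := by omega
  rw [ht] at h
  unfold wordZ at h
  rw [List.getD_eq_getElem?_getD, List.getElem?_map] at h
  rw [List.getD_eq_getElem?_getD]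
  rcases hg : (getElem? win (am - 600) : Option ℕ) with _ | y
  · rw [hg] at h; simp at h; simpa using h
  · rw [hg] at h; simp at h; exact_mod_cast h

/-- ★ lens-2's `n9F ℓ` of a lifted piece IS the kernel's `n9Z` of its vector under `rhoOf ℓ`. [folklore] -/
theorem n9F_liftN_rho {ℓ : ℤ → ℤ} (hℓ : IsLetterSeq ℓ) (pr : (ℕ × ℕ × ℕ) × (ℕ × ℕ × ℕ)) :
    n9F ℓ (liftN pr) = n9Z (vecL (rhoOf ℓ) pr) := by
  simp only [n9F, refF0, refF1, liftN, siteN, Matrix.cons_val_zero, Matrix.cons_val_one, n9Z, vecL, rhoOf_cast hℓ]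
  ring

/-- ★ lens-2's `d18F ℓ` of two lifted pieces IS the kernel's `d18Z` of their vectors under `rhoOf ℓ`. [folklore] -/
theorem d18F_liftN_rho {ℓ : ℤ → ℤ} (hℓ : IsLetterSeq ℓ) (pr pr' : (ℕ × ℕ × ℕ) × (ℕ × ℕ × ℕ)) :
    d18F ℓ (liftN pr) (liftN pr') = d18Z (vecL (rhoOf ℓ) pr) (vecL (rhoOf ℓ) pr') := by
  simp only [d18F, refF0, refF1, liftN, siteN, Matrix.cons_val_zero, Matrix.cons_val_one, d18Z_eq, vecL, rhoOf_cast hℓ]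
  ring

/-- the decoded chord's ideal length under `ℓ` is the kernel's `n9Z (chordEO (rhoOf ℓ) (600 + mX) c)`. [folklore] -/
theorem n9F_decodeChord_fst_rho {ℓ : ℤ → ℤ} (hℓ : IsLetterSeq ℓ) (mX : ℕ) (c : List ℕ) :
    n9F ℓ (decodeChord mX c).1 = n9Z (chordEO (rhoOf ℓ) (600 + mX) c) := by
  rw [decodeChord_fst, n9F_liftN_rho hℓ]; rfl

/-- the decoded chord's `d18F` against a lifted piece is the kernel's `d18Z`. [folklore] -/
theorem d18F_decodeChord_fst_rho {ℓ : ℤ → ℤ} (hℓ : IsLetterSeq ℓ) (mX : ℕ) (c : List ℕ) (pr : (ℕ × ℕ × ℕ) × (ℕ × ℕ × ℕ)) :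
    d18F ℓ (decodeChord mX c).1 (liftN pr) = d18Z (chordEO (rhoOf ℓ) (600 + mX) c) (vecL (rhoOf ℓ) pr) := by
  rw [decodeChord_fst, d18F_liftN_rho hℓ]; rfl

/-! ### the key in window currency -/

/-- the ℕ code of a RAW signed piece key `(m, Δγ₀, Δγ₁, Δm)` in window currency (the out kernel's `keyO`: shifted start layer `m + 600`). -/
def codeKO (k : ℤ × ℤ × ℤ × ℤ) : ℕ :=
  (((k.1 + 600).toNat * 1201 + (k.2.1 + 600).toNat) * 1201 + (k.2.2.1 + 600).toNat) * 1201 + (k.2.2.2 + 600).toNat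

/-- ★ THE OUT KEY: for a piece without truncation the kernel's `keyOf` is the code of lens-2's raw key `pieceKeyF` of the lifted piece. [folklore] -/
theorem keyOf_eq_codeKO (pr : (ℕ × ℕ × ℕ) × (ℕ × ℕ × ℕ)) (h0 : pr.1.1 ≤ pr.2.1 + 600) (h1 : pr.1.2.1 ≤ pr.2.2.1 + 600)
    (hm : pr.1.2.2 ≤ pr.2.2.2 + 600) : keyOf pr = codeKO (pieceKeyF (liftN pr)) := by
  obtain ⟨⟨a0, a1, am⟩, ⟨b0, b1, bm⟩⟩ := pr
  simp only at h0 h1 hm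
  have em0 : ((am : ℤ) - 600 + 600).toNat = am := by simp
  have e0 : ((b0 : ℤ) - 600 - ((a0 : ℤ) - 600) + 600).toNat = b0 + 600 - a0 := by
    have : (b0 : ℤ) - 600 - ((a0 : ℤ) - 600) + 600 = ((b0 + 600 - a0 : ℕ) : ℤ) := by push_cast [Nat.cast_sub h0]; ring
    rw [this, Int.toNat_natCast]
  have e1 : ((b1 : ℤ) - 600 - ((a1 : ℤ) - 600) + 600).toNat = b1 + 600 - a1 := by
    have : (b1 : ℤ) - 600 - ((a1 : ℤ) - 600) + 600 = ((b1 + 600 - a1 : ℕ) : ℤ) := by push_cast [Nat.cast_sub h1]; ring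
    rw [this, Int.toNat_natCast]
  have e2 : ((bm : ℤ) - 600 - ((am : ℤ) - 600) + 600).toNat = bm + 600 - am := by
    have : (bm : ℤ) - 600 - ((am : ℤ) - 600) + 600 = ((bm + 600 - am : ℕ) : ℤ) := by push_cast [Nat.cast_sub hm]; ring
    rw [this, Int.toNat_natCast]
  simp only [keyOf, keyO, codeKO, pieceKeyF, liftN, siteN, Matrix.cons_val_zero, Matrix.cons_val_one, em0, e0, e1, e2]

/-! ### coefficients in letter-sequence currency -/

/-- the R coefficient `n·45927/u9⁴` is dominated by the kernel's dyadic `coefRn / 2^E` (`u9 > 0`). [folklore] -/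
theorem coefR_real_le (E n : ℕ) {u9 : ℤ} (hu : 0 < u9) :
    (n : ℝ) * 45927 / (u9 : ℝ) ^ 4 ≤ (coefRn (2 ^ E * 45927 * n) u9.toNat : ℝ) / 2 ^ E := by
  have hun : ((u9.toNat : ℕ) : ℤ) = u9 := Int.toNat_of_nonneg hu.le
  have hunR : ((u9.toNat : ℕ) : ℝ) = (u9 : ℝ) := by exact_mod_cast hun
  have hupos : (0 : ℝ) < (u9 : ℝ) := by exact_mod_cast hu
  have hb : 0 < u9.toNat * u9.toNat * (u9.toNat * u9.toNat) := by
    have : 0 < u9.toNat := by omega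
    positivity
  have h := div_pow_le_ceilDivNat (2 ^ E * 45927 * n) E hb
  have heq : (n : ℝ) * 45927 / (u9 : ℝ) ^ 4 =
      ((2 ^ E * 45927 * n : ℕ) : ℝ) / (2 ^ E * ((u9.toNat * u9.toNat * (u9.toNat * u9.toNat) : ℕ) : ℝ)) := by
    push_cast
    rw [hunR]
    field_simp
  rw [heq]
  exact h

/-- ★ the R coefficient of a decoded out-chord under `ℓ` is dominated by the kernel's dyadic `coefRn / 2^E` at `u9 = n9Z (chordEO ρ …)`. -/
theorem coefR0F_le_rho {ℓ : ℤ → ℤ} (hℓ : IsLetterSeq ℓ) {E mX : ℕ} {c : List ℕ} (hc : c ≠ [])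
    (hu : 0 < n9Z (chordEO (rhoOf ℓ) (600 + mX) c)) :
    coefR0F ℓ (decodeChord mX c) ≤ (coefRn (2 ^ E * 45927 * c.length) (n9Z (chordEO (rhoOf ℓ) (600 + mX) c)).toNat : ℝ) / 2 ^ E := by
  unfold coefR0F
  rw [chordNp_decodeChord mX hc, n9F_decodeChord_fst_rho hℓ]
  exact coefR_real_le E c.length hu

/-- the N coefficient `n·45927·(1 − d²/(4·u9·p9))/u9⁴` is dominated by the kernel's dyadic `coefNn / 2^E` (Cauchy–Schwarz makes the ℕ
subtraction exact). [folklore] -/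
theorem coefN_real_le (E n : ℕ) {e v : ℤ × ℤ × ℤ} (hu : 0 < n9Z e) (hv : 0 < n9Z v) :
    (n : ℝ) * 45927 * (1 - (d18Z e v : ℝ) ^ 2 / (4 * (n9Z e : ℝ) * n9Z v)) / (n9Z e : ℝ) ^ 4 ≤
      (coefNn (2 ^ E * 45927 * n) (4 * ((n9Z e).toNat * (n9Z e).toNat * ((n9Z e).toNat * (n9Z e).toNat)) * (n9Z e).toNat)
          (4 * (n9Z e).toNat) (n9Z v).toNat (d18Z e v).natAbs : ℝ) / 2 ^ E := by
  set u9 := n9Z e with hu9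
  set p9 := n9Z v with hp9
  set d := d18Z e v with hd
  have hun : ((u9.toNat : ℕ) : ℤ) = u9 := Int.toNat_of_nonneg hu.le
  have hpn : ((p9.toNat : ℕ) : ℤ) = p9 := Int.toNat_of_nonneg hv.le
  have hdn : ((d.natAbs : ℕ) : ℤ) * d.natAbs = d * d := Int.natAbs_mul_self' d
  have hCS : d * d ≤ 4 * u9 * p9 := by
    have h := d18_sq_le_four_n9_n9 e.1 e.2.1 e.2.2 v.1 v.2.1 v.2.2
    rw [hd, d18Z_eq, hu9, hp9]
    simp only [n9Z]
    nlinarith [h]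
  have hCSn : d.natAbs * d.natAbs ≤ 4 * u9.toNat * p9.toNat := by
    have : ((d.natAbs * d.natAbs : ℕ) : ℤ) ≤ ((4 * u9.toNat * p9.toNat : ℕ) : ℤ) := by
      rw [Nat.cast_mul, hdn, Nat.cast_mul, Nat.cast_mul, hun, hpn]
      exact_mod_cast hCS
    exact_mod_cast this
  have hb : 0 < 4 * (u9.toNat * u9.toNat * (u9.toNat * u9.toNat)) * u9.toNat * p9.toNat := by
    have : 0 < u9.toNat := by omega
    have : 0 < p9.toNat := by omega
    positivity
  have h := div_pow_le_ceilDivNat (2 ^ E * 45927 * n * (4 * u9.toNat * p9.toNat - d.natAbs * d.natAbs)) E hb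
  have hunR : ((u9.toNat : ℕ) : ℝ) = (u9 : ℝ) := by exact_mod_cast hun
  have hpnR : ((p9.toNat : ℕ) : ℝ) = (p9 : ℝ) := by exact_mod_cast hpn
  have hdnR : |(d : ℝ)| * |(d : ℝ)| = (d : ℝ) * d := abs_mul_abs_self _
  have hupos : (0 : ℝ) < (u9 : ℝ) := by exact_mod_cast hu
  have hppos : (0 : ℝ) < (p9 : ℝ) := by exact_mod_cast hv
  have heq : (n : ℝ) * 45927 * (1 - (d : ℝ) ^ 2 / (4 * (u9 : ℝ) * p9)) / (u9 : ℝ) ^ 4 =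
      ((2 ^ E * 45927 * n * (4 * u9.toNat * p9.toNat - d.natAbs * d.natAbs) : ℕ) : ℝ) /
        (2 ^ E * ((4 * (u9.toNat * u9.toNat * (u9.toNat * u9.toNat)) * u9.toNat * p9.toNat : ℕ) : ℝ)) := by
    have hsub : ((4 * u9.toNat * p9.toNat - d.natAbs * d.natAbs : ℕ) : ℝ) = 4 * (u9 : ℝ) * p9 - (d : ℝ) * d := by
      rw [Nat.cast_sub hCSn]
      push_cast
      rw [hunR, hpnR]
      simp only [Nat.cast_natAbs, Int.cast_abs, hdnR]
    rw [Nat.cast_mul, hsub]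
    push_cast
    rw [hunR, hpnR]
    field_simp
  rw [heq]
  unfold coefNn
  exact h

/-- ★ the N coefficient of a decoded out-chord at a lifted piece under `ℓ` is dominated by the kernel's dyadic `coefNn / 2^E`. [folklore] -/
theorem coefN0F_le_rho {ℓ : ℤ → ℤ} (hℓ : IsLetterSeq ℓ) {E mX : ℕ} {c : List ℕ} (hc : c ≠ [])
    (hu : 0 < n9Z (chordEO (rhoOf ℓ) (600 + mX) c)) {i : ℕ} {pr : (ℕ × ℕ × ℕ) × (ℕ × ℕ × ℕ)}
    (hpr : chordPiece (decodeChord mX c) i = liftN pr) (hv : 0 < n9Z (vecL (rhoOf ℓ) pr)) :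
    coefN0F ℓ (decodeChord mX c) i ≤
      (coefNn (2 ^ E * 45927 * c.length)
          (4 * ((n9Z (chordEO (rhoOf ℓ) (600 + mX) c)).toNat * (n9Z (chordEO (rhoOf ℓ) (600 + mX) c)).toNat *
            ((n9Z (chordEO (rhoOf ℓ) (600 + mX) c)).toNat * (n9Z (chordEO (rhoOf ℓ) (600 + mX) c)).toNat)) *
            (n9Z (chordEO (rhoOf ℓ) (600 + mX) c)).toNat)
          (4 * (n9Z (chordEO (rhoOf ℓ) (600 + mX) c)).toNat) (n9Z (vecL (rhoOf ℓ) pr)).toNat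
          (d18Z (chordEO (rhoOf ℓ) (600 + mX) c) (vecL (rhoOf ℓ) pr)).natAbs : ℝ) / 2 ^ E := by
  unfold coefN0F
  rw [chordNp_decodeChord mX hc, hpr, n9F_decodeChord_fst_rho hℓ, d18F_decodeChord_fst_rho hℓ, n9F_liftN_rho hℓ]
  exact coefN_real_le E c.length hu hv

end Summit.AtomisticToContinuum.Crystallization.Theorems.ChartedZeroExcessLayeredLatticeLiouville.ThetaKernel
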